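import Summits.Ventures.LatticeQCDFlow.Scaling.TaggedCostSideDeepTwo
import Summits.Ventures.LatticeQCDFlow.Scaling.StarOccupationComparison
import Summits.Ventures.LatticeQCDFlow.Scaling.TaggedDomination

/-!
HONEST FRAMING: exact (Metropolis-corrected) sampling algorithms for lattice gauge theory; figures
of merit are autocorrelation/cost numbers at stated couplings and volumes; no continuum-physics
claim.

# TaggedPerAttemptCertificateDeepAll — CONJECTURE W′ (THE `σ`-WEIGHTED PER-ATTEMPT CERTIFICATE) FOR A DEPTH-ADJACENT PAIR IN THE DEEP CONFIGURATION, EVERY `K ≥ 2`: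
# `L·(x̃(★) + (x̃(a) − ỹ(a)) − D_J) ≥ cost(x̃) + cost(ỹ)` FOR EVERY TRUNCATION `J` OF THE DISCOUNTED START-CONTENT DEFICIT `D_J = Σ_{n<J}(1−σ)σⁿ(y_{n+1}(z) − x_{n+1}(z))⁺`
# (lean-2 GEN-42, ours)

Venture-side (OURS).  Cell `lqcd-flow` (pub-lqcd), unit `pub-lqcd-lean-2-g42`, 2026-08-30.  Chapter AB (route (β), the cost side continued), file 2 = GEN-41 file 8
(`tagged_perAttempt_certificate_deep`, `K ≥ 3`) with its cost-side input replaced by file 1's `tagged_costSide_deep_all` (`K ≥ 2`: the second step's income pays at `K = 2`).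
For the tagged chains of W14∕W26 from an ordinary hub `z` with `W_z ≤ W_b ≤ W_a`, `W_z < W_a` (the tie `W_b = W_z` included), no present content strictly between `W_b` and `W_a`,
three particles at or above `z` (`N_C(z) ≥ 2` or a content strictly above `z`), every `K ≥ 2`, no presence proviso:

* **`tagged_perAttempt_certificate_deep_all`**: `cost(x̃) + cost(ỹ) ≤ L·(x̃(★) + (x̃(a) − ỹ(a)) − D_J)` for every `J`, `L = 2K + M_X + M_Y` — GEN-41 file 4's decomposition, W21
  `S2_of_star_domination`, W26 `tagged_hub_domination`, file 1.

With GEN-41 file 10 (the fourth configuration, every `K ≥ 2`) and configuration (C) (no deficit: W16) this leaves, on depth-adjacent edges, the residual pair and the exact ties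
(memo MEMO-gen42).  Literature grade (cell rule): OWN; nothing cited; no new bib keys.
-/

open Finset

namespace Summit.Ventures.LatticeQCDFlow.Scaling

section PerAttemptDeepAll
variable {S : Type*} [Fintype S] [DecidableEq S]
variable {W θ : S → ℝ} {acc : S → S → ℝ} {p σ : ℝ} {K : ℕ} {NC : S → ℕ} {a b : S} {PX PY : Option S → Option S → ℝ}

/-- **CONJECTURE W′ ON A DEPTH-ADJACENT EDGE, DEEP CONFIGURATION, EVERY `K ≥ 2`** (see the module docstring). [ours] -/
theorem tagged_perAttempt_certificate_deep_all (hW : ∀ v, 0 < W v) (hp0 : 0 ≤ p) (hp : ∀ v, p * W v ≤ 1) (hθ : ∀ v, θ v = 1 / (1 + p * W v))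
    (hacc : ∀ h v, acc h v = min 1 (W h / W v)) (hK : 2 ≤ K) (hNC : ∑ v, NC v = K) (hab : W b ≤ W a)
    (hnone : ∀ w, NC w ≠ 0 → ¬ (W b < W w ∧ W w < W a))
    (hPXoff : ∀ h v, h ≠ v → PX (some h) (some v) = if NC h = 0 then 0 else (NC v : ℝ) / K * acc h v)
    (hPXin : ∀ h, PX (some h) none = if NC h = 0 then 0 else acc h a / K)
    (hPXdiag : ∀ h, PX (some h) (some h) = 1 - (∑ v ∈ univ.erase h, PX (some h) (some v) + PX (some h) none))
    (hPXout : ∀ v, PX none (some v) = (NC v : ℝ) / K * acc a v) (hPXstay : PX none none = 1 - ∑ v, PX none (some v))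
    (hPYoff : ∀ h v, h ≠ v → PY (some h) (some v) = if NC h = 0 then 0 else (NC v : ℝ) / K * acc h v)
    (hPYin : ∀ h, PY (some h) none = if NC h = 0 then 0 else acc h b / K)
    (hPYdiag : ∀ h, PY (some h) (some h) = 1 - (∑ v ∈ univ.erase h, PY (some h) (some v) + PY (some h) none))
    (hPYout : ∀ v, PY none (some v) = (NC v : ℝ) / K * acc b v) (hPYstay : PY none none = 1 - ∑ v, PY none (some v))
    {z : S} (hz : NC z ≠ 0) (hzb : W z ≤ W b) (hza : W z < W a) (hthree : 2 ≤ NC z ∨ ∃ w, NC w ≠ 0 ∧ W z < W w)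
    {x y : ℕ → Option S → ℝ}
    (hx0 : ∀ v, x 0 v = if v = some z then 1 else 0) (hxs : ∀ n v, x (n + 1) v = ∑ h, x n h * PX h v)
    (hy0 : ∀ v, y 0 v = if v = some z then 1 else 0) (hys : ∀ n v, y (n + 1) v = ∑ h, y n h * PY h v)
    {M : ℝ} (hM : M = ∑ v, θ v * (NC v : ℝ) + θ a) {L : ℝ} (hL : L = 2 * K + M + (∑ v, θ v * (NC v : ℝ) + θ b))
    (hσ0 : 0 ≤ σ) (hσ1 : σ < 1) {xt yt xs ys : Option S → ℝ}
    (hxt : ∀ t, xt t = (1 - σ) * PX (some z) t + σ * ∑ t', xt t' * PX t' t) (hyt : ∀ t, yt t = (1 - σ) * PY (some z) t + σ * ∑ t', yt t' * PY t' t)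
    (hxsr : ∀ t, xs t = (1 - σ) * PX none t + σ * ∑ t', xs t' * PX t' t) (hysr : ∀ t, ys t = (1 - σ) * PY none t + σ * ∑ t', ys t' * PY t' t) (J : ℕ) :
    (∑ v, xt (some v) * (1 - θ v) + xt none * (1 - θ a)) + (∑ v, yt (some v) * (1 - θ v) + yt none * (1 - θ b))
      ≤ L * (xt none + (xt (some a) - yt (some a)) - ∑ n ∈ range J, (1 - σ) * σ ^ n * max 0 (y (n + 1) (some z) - x (n + 1) (some z))) := by
  have hK1 : 1 ≤ K := by omega
  have hθm := theta_mem hW hp0 hp hθ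
  -- the exact decomposition (file 4)
  have hMY : (∑ v, θ v * (NC v : ℝ) + θ b) = M + (θ b - θ a) := by rw [hM]; ring
  have hdec := ledger_perStep_eq (θ := θ) (x := xt) (y := yt) (z := z) (a := a)
    (pen := ∑ n ∈ range J, (1 - σ) * σ ^ n * max 0 (y (n + 1) (some z) - x (n + 1) (some z))) hMY hL
  -- the incomes
  -- (i) `s3 ≥ 0`
  have hDstar := tagged_star_domination hW hacc hK1 hNC hab hPXoff hPXin hPXdiag hPXout hPXstay hPYoff hPYin hPYdiag hPYout hPYstay hσ0 hσ1 hxsr hysr z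
  have hs3 := S2_of_star_domination hW hp0 hp hθ hacc hK1 hNC hab hPXoff hPXin hPXdiag hPXout hPXstay hPYoff hPYin hPYout hσ0 hσ1 hz hxt hyt hxsr hysr hDstar
  -- (ii) domination from the hub at every ordinary content (W26), in particular at `a` and at `z`
  have hdom := tagged_hub_domination hW hacc hK1 hNC hab hPXoff hPXin hPXdiag hPXout hPXstay hPYoff hPYin hPYdiag hPYout hPYstay hσ0 hσ1 hz hxt hyt
  have hgap_a : 0 ≤ xt (some a) - yt (some a) := by linarith [hdom a]
  have hgaps : 0 ≤ ∑ v ∈ univ.erase z, (xt (some v) - yt (some v)) * (1 - θ v) :=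
    sum_nonneg fun v _ => mul_nonneg (by linarith [hdom v]) (by linarith [(hθm v).2])
  have hez : 0 ≤ -((1 - θ z) * (yt (some z) - xt (some z))) := by
    have h1 : 0 ≤ 1 - θ z := by linarith [(hθm z).2]
    have h2 : yt (some z) - xt (some z) ≤ 0 := by linarith [hdom z]
    nlinarith
  -- (iii) the cost side (file 1: every `K ≥ 2`)
  have hcost := tagged_costSide_deep_all hW hp0 hp hθ hacc hK hNC hab hnone hPXoff hPXin hPXdiag hPXout hPXstay hPYoff hPYin hPYdiag hPYout hPYstay
    hz hzb hza hthree hx0 hxs hy0 hys hM hL hσ0 hσ1 hxt J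
  -- `L ≥ 0`
  have hMC0 : 0 ≤ ∑ v, θ v * (NC v : ℝ) := sum_nonneg fun v _ => mul_nonneg (by linarith [(hθm v).1]) (Nat.cast_nonneg _)
  have hL0 : 0 ≤ L := by
    have hK0 : (0 : ℝ) ≤ K := Nat.cast_nonneg _
    rw [hL, hM]; nlinarith [(hθm a).1, (hθm b).1]
  -- assemble
  have key : 0 ≤ L * (xt none + (xt (some a) - yt (some a)) - ∑ n ∈ range J, (1 - σ) * σ ^ n * max 0 (y (n + 1) (some z) - x (n + 1) (some z)))
      - (∑ v, xt (some v) * (1 - θ v) + xt none * (1 - θ a)) - (∑ v, yt (some v) * (1 - θ v) + yt none * (1 - θ b)) := by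
    rw [hdec]
    have hga : 0 ≤ L * (xt (some a) - yt (some a)) := mul_nonneg hL0 hgap_a
    nlinarith [hs3, hga, hgaps, hez, hcost]
  linarith

end PerAttemptDeepAll

end Summit.Ventures.LatticeQCDFlow.Scaling
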